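import Summits.QuantumFields.YangMills.Theorems.PoincareLipschitzSphereMapSmallRangeEnergyDecayTwisted
import Summits.QuantumFields.YangMills.Theorems.PoincareLipschitzSphereMapSmallRangeCaccioppoliTwisted
import Summits.QuantumFields.YangMills.Theorems.PoincareLipschitzSphereMapSmallRangeHolder
import Summits.QuantumFields.YangMills.Theorems.PoincareLipschitzSphereMapSmallRangeIterationArith
import HarnessLib

/-!
# Small-range regularity of one-site-optimal sphere maps, TWISTED — FILE 3-τ: Campanato iteration with a twist source, the twisted Hölder radius law

SEAT ym3-torus-px7 g5 (helper for `stmt-QuantumFields-19936`, K2 END-GAME lane [D] of LEAD ym-ust-19936-w1 g8, rulings 05:29:02Z «STOP AT HÖLDER» and 05:44:26Z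
«[D] (px7 2-τ∕3-τ)»).  The twisted twin of ✓`PoincareLipschitzSphereMapSmallRangeHolder` (✓p699063): the FLAT energies of ✓`smallRange_energy_decay_twisted` (FILE 2-τ)
are iterated along the radii `m^k − 1` with the additive twist source `(4A+2)·8dωτ₀·(2r+1)^d` summed geometrically (`Σ_{k<K} θ^k S_k ≤ C·ωτ₀·m^K`), the top scale is
✓`smallRange_caccioppoli_twisted` (FILE 1b) read through `‖u(y+e) − u(y)‖² ≤ 2‖τ(u(y+e)) − u(y)‖² + 2τ₀²`, and the flat centre bond is turned back into the twisted one.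

WHAT IS PROVED (ns `…SphereMapSmallRangeHolderTwisted`; the real arithmetic is FILE 3a-τ ✓`…SmallRangeIterationArith`): §2 `flatEnergy_le_twisted`; §3 `decay_step_twisted`,
`top_scale_twisted`; §4 ★★ `smallRange_energy_at_centre_le_twisted`; §5 ★★★ `smallRange_holder_law_twisted` (+ primed form without the divergence letter, `τ₁ := 2dτ₀`):
`∃ ω₀ C > 0, ∀ τ u p x₀ R ω τ₀ τ₁, … (unit sphere, ‖u − p‖ ≤ ω, transports of sup defect τ₀ on Q_{2R+1}(x₀), divergence defect τ₁ and twisted one-site optimality on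
Q_{2R}(x₀), ω + τ₀ ≤ ω₀, τ₁ ≤ 1) → ‖τ μ x₀ (u(x₀+e_μ)) − u(x₀)‖² ≤ C·(ω²∕R + (τ₀ + τ₁)·R)` — the bond law `‖D_τu‖ ≲ ω∕√R + √(τ₀+τ₁)·√R` of the frozen K2 face v2
shape `Λ((√R)⁻¹ + √θ·√R)` once `τ₀, τ₁ ≲ θ`.
HONEST SCOPE.  [folklore] ([Giaquinta1984] Ch. III Lemma 2.1 p.86 (iteration with a source), Ch. VI §1 Thm 1.1 pp.128–131; [Balaban1985BackgroundPropagators] §3 for the twist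
bookkeeping).  A helper; proves nothing of `hImprove`∕`hRegH`∕`stmt-QuantumFields-19936`; YM₃ on T³ is rung R3, not Clay.
-/

set_option autoImplicit false

noncomputable section

open scoped BigOperators InnerProductSpace
open Finset

namespace Summit.QuantumFields.YangMills.Theorems.PoincareLipschitzSphereMapSmallRangeHolderTwisted

open Literature.MathematicalPhysics.QuantumFieldTheory.Balaban1983to89
open B4Eq19LatticeOperators
open Summit.QuantumFields.YangMills.Theorems.PoincareLipschitzSphereMapSmallRangeTwistedLetters (norm_sub_le_covD_add norm_symm_sub_le)
open Summit.QuantumFields.YangMills.Theorems.PoincareLipschitzSphereMapSmallRangeCaccioppoliTwisted (smallRange_caccioppoli_twisted)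
open Summit.QuantumFields.YangMills.Theorems.PoincareLipschitzSphereMapSmallRangeEnergyDecayTwisted (smallRange_energy_decay_twisted)
open Summit.QuantumFields.YangMills.Theorems.PoincareLipschitzSphereMapSmallRangeHolder (pow_ratio_le)
open Summit.QuantumFields.YangMills.Theorems.PoincareLipschitzSphereMapSmallRangeIterationArith
  (geometric_iter_add sum_pow_le_pow top_scale_arith step_factor_le theta_pow_mul_pow source_term_le)

variable {d : ℕ} {V : Type*} [NormedAddCommGroup V] [InnerProductSpace ℝ V]

/-! ## §2 Flat energy versus twisted energy -/

/-- `Σ_{Q}Σ_μ ‖u(y+e_μ) − u(y)‖² ≤ 2·Σ_{Q}Σ_μ ‖τ μ y (u(y+e_μ)) − u(y)‖² + 2dτ₀²·#Q` for a unit field and transports of defect `≤ τ₀` on `Q`. [folklore] -/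
theorem flatEnergy_le_twisted (τ : Fin d → Zd d → (V ≃ₗᵢ[ℝ] V)) (u : Zd d → V) (Q : Finset (Zd d)) {τ₀ : ℝ}
    (hu1 : ∀ y ∈ Q, ∀ μ, ‖u (y + unitVec μ)‖ = 1) (hdef : ∀ y ∈ Q, ∀ μ (v : V), ‖τ μ y v - v‖ ≤ τ₀ * ‖v‖) :
    ∑ y ∈ Q, ∑ μ, ‖u (y + unitVec μ) - u y‖ ^ 2 ≤ 2 * ∑ y ∈ Q, ∑ μ, ‖τ μ y (u (y + unitVec μ)) - u y‖ ^ 2 + 2 * d * τ₀ ^ 2 * Q.card := by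
  have hpt : ∀ y ∈ Q, ∑ μ, ‖u (y + unitVec μ) - u y‖ ^ 2 ≤ 2 * ∑ μ, ‖τ μ y (u (y + unitVec μ)) - u y‖ ^ 2 + 2 * d * τ₀ ^ 2 := by
    intro y hy
    have hb : ∀ μ, ‖u (y + unitVec μ) - u y‖ ^ 2 ≤ 2 * ‖τ μ y (u (y + unitVec μ)) - u y‖ ^ 2 + 2 * τ₀ ^ 2 := by
      intro μ
      have h1 := norm_sub_le_covD_add (τ μ y) (hdef y hy μ) (a := u y) (hu1 y hy μ)
      have h0 : 0 ≤ ‖u (y + unitVec μ) - u y‖ := norm_nonneg _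
      nlinarith [h1, h0, sq_nonneg (‖τ μ y (u (y + unitVec μ)) - u y‖ - τ₀)]
    calc ∑ μ, ‖u (y + unitVec μ) - u y‖ ^ 2 ≤ ∑ μ, (2 * ‖τ μ y (u (y + unitVec μ)) - u y‖ ^ 2 + 2 * τ₀ ^ 2) := Finset.sum_le_sum fun μ _ => hb μ
      _ = 2 * ∑ μ, ‖τ μ y (u (y + unitVec μ)) - u y‖ ^ 2 + 2 * d * τ₀ ^ 2 := by
          rw [Finset.sum_add_distrib, Finset.sum_const, Finset.card_univ, Fintype.card_fin, nsmul_eq_mul, Finset.mul_sum]; ring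
  calc ∑ y ∈ Q, ∑ μ, ‖u (y + unitVec μ) - u y‖ ^ 2 ≤ ∑ y ∈ Q, (2 * ∑ μ, ‖τ μ y (u (y + unitVec μ)) - u y‖ ^ 2 + 2 * d * τ₀ ^ 2) :=
        Finset.sum_le_sum hpt
    _ = 2 * ∑ y ∈ Q, ∑ μ, ‖τ μ y (u (y + unitVec μ)) - u y‖ ^ 2 + 2 * d * τ₀ ^ 2 * Q.card := by
        rw [Finset.sum_add_distrib, Finset.sum_const, nsmul_eq_mul, Finset.mul_sum]; ring


/-! ## §3 One decay step and the top scale -/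

/-- ONE TWISTED DECAY STEP between the radii `m^k − 1` and `m^{k+1} − 1` (FILE 2-τ at `ρ = m^k − 1`, `r = m^{k+1} − 2`, factor `≤ m^{−(d−1)}` by `step_factor_le`).
[folklore] [cite: Giaquinta1984, Ch. VI §1 Thm 1.1 pp.128-131] -/
theorem decay_step_twisted [FiniteDimensional ℝ V] (hd : 1 ≤ d) (τ : Fin d → Zd d → (V ≃ₗᵢ[ℝ] V)) (u : Zd d → V) (p : V) (x₀ : Zd d) {m : ℕ}
    (hm : 8 * ((2 : ℝ) ^ d * (1 + 56 * d) ^ d * (8 * ((d : ℝ) + 1)) ^ (d + 1)) * 2 ^ d + 4 ≤ m) (k : ℕ) {ω τ₀ : ℝ} (hω0 : 0 ≤ ω) (hτ0 : 0 ≤ τ₀)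
    (hωsmall : ω ≤ ((m : ℝ) ^ (d - 1))⁻¹ / (4 * (8 * ((2 : ℝ) ^ d * (1 + 56 * d) ^ d * (8 * ((d : ℝ) + 1)) ^ (d + 1)) + 4)))
    (hu1 : ∀ y ∈ box x₀ ((m : ℤ) ^ (k + 1)), ‖u y‖ = 1) (hω : ∀ y ∈ box x₀ ((m : ℤ) ^ (k + 1)), ‖u y - p‖ ≤ ω)
    (hdef : ∀ y ∈ box x₀ ((m : ℤ) ^ (k + 1) - 1), ∀ μ (v : V), ‖τ μ y v - v‖ ≤ τ₀ * ‖v‖)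
    (hopt : ∀ y ∈ box x₀ ((m : ℤ) ^ (k + 1) - 1),
      ‖∑ μ, (τ μ y (u (y + unitVec μ)) + (τ μ (y - unitVec μ)).symm (u (y - unitVec μ)))‖ • u y =
        ∑ μ, (τ μ y (u (y + unitVec μ)) + (τ μ (y - unitVec μ)).symm (u (y - unitVec μ)))) :
    ∑ y ∈ box x₀ ((m : ℤ) ^ k - 1), ∑ μ, ‖u (y + unitVec μ) - u y‖ ^ 2 ≤
      ((m : ℝ) ^ (d - 1))⁻¹ * ∑ y ∈ box x₀ ((m : ℤ) ^ (k + 1) - 1), ∑ μ, ‖u (y + unitVec μ) - u y‖ ^ 2 +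
        (4 * ((2 : ℝ) ^ d * (1 + 56 * d) ^ d * (8 * ((d : ℝ) + 1)) ^ (d + 1)) + 2) * (8 * d * ω * τ₀) * (2 * (m : ℝ) ^ (k + 1) - 3) ^ d := by
  set A : ℝ := (2 : ℝ) ^ d * (1 + 56 * d) ^ d * (8 * ((d : ℝ) + 1)) ^ (d + 1) with hA
  have hA0 : 0 ≤ A := by positivity
  have h2d : (1 : ℝ) ≤ (2 : ℝ) ^ d := one_le_pow₀ (by norm_num)
  have hm4R : (4 : ℝ) ≤ m := by nlinarith
  have hm4 : 4 ≤ m := by exact_mod_cast hm4R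
  have hmk1 : (1 : ℤ) ≤ (m : ℤ) ^ k := one_le_pow₀ (by exact_mod_cast (show 1 ≤ m by omega))
  have hmk1' : (4 : ℤ) ≤ (m : ℤ) ^ (k + 1) := by
    calc (4 : ℤ) ≤ (m : ℤ) := by exact_mod_cast hm4
      _ = (m : ℤ) ^ 1 := (pow_one _).symm
      _ ≤ (m : ℤ) ^ (k + 1) := pow_le_pow_right₀ (by linarith) (by omega)
  have hρr : (m : ℤ) ^ k - 1 + 1 ≤ (m : ℤ) ^ (k + 1) - 2 := by
    have : (m : ℤ) ^ k * 4 ≤ (m : ℤ) ^ k * m := mul_le_mul_of_nonneg_left (by exact_mod_cast hm4) (by linarith)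
    rw [pow_succ]; nlinarith
  have hdec := smallRange_energy_decay_twisted hd τ u p x₀ (ρ := (m : ℤ) ^ k - 1) (r := (m : ℤ) ^ (k + 1) - 2) (by linarith) (by linarith) hρr
    hω0 hτ0 (fun y hy => hu1 y (by rw [show (m : ℤ) ^ (k + 1) - 2 + 2 = (m : ℤ) ^ (k + 1) by ring] at hy; exact hy))
    (fun y hy => hω y (by rw [show (m : ℤ) ^ (k + 1) - 2 + 2 = (m : ℤ) ^ (k + 1) by ring] at hy; exact hy))
    (fun y hy μ v => hdef y (by rw [show (m : ℤ) ^ (k + 1) - 2 + 1 = (m : ℤ) ^ (k + 1) - 1 by ring] at hy; exact hy) μ v)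
    (fun y hy => hopt y (by rw [show (m : ℤ) ^ (k + 1) - 2 + 1 = (m : ℤ) ^ (k + 1) - 1 by ring] at hy; exact hy))
  rw [← hA] at hdec
  have er : ((m : ℤ) ^ (k + 1) - 2 + 1 : ℤ) = (m : ℤ) ^ (k + 1) - 1 := by ring
  have ec : ((2 * ((m : ℤ) ^ (k + 1) - 2) + 1 : ℤ) : ℝ) = 2 * (m : ℝ) ^ (k + 1) - 3 := by push_cast; ring
  rw [er, ec] at hdec
  have hq : ((((((m : ℤ) ^ k - 1 : ℤ) : ℝ)) + 1) / ((((m : ℤ) ^ (k + 1) - 2 : ℤ) : ℝ))) ^ d ≤ (2 / (m : ℝ)) ^ d := by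
    have e1 : ((((m : ℤ) ^ k - 1 : ℤ) : ℝ)) + 1 = (m : ℝ) ^ k := by push_cast; ring
    have e2 : ((((m : ℤ) ^ (k + 1) - 2 : ℤ) : ℝ)) = (m : ℝ) ^ (k + 1) - 2 := by push_cast; ring
    rw [e1, e2]; exact pow_ratio_le hm4 k d
  have hfac := step_factor_le hd hA0 h2d hm hωsmall hq
  have hE0 : 0 ≤ ∑ y ∈ box x₀ ((m : ℤ) ^ (k + 1) - 1), ∑ μ, ‖u (y + unitVec μ) - u y‖ ^ 2 :=
    Finset.sum_nonneg fun _ _ => Finset.sum_nonneg fun _ _ => sq_nonneg _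
  exact hdec.trans (add_le_add (mul_le_mul_of_nonneg_right hfac hE0) le_rfl)

/-- THE TOP SCALE: FILE 1b at `ρ = m^K − 1`, `s = m^K` read through `flatEnergy_le_twisted`; `M = m^K`, `X` the bracket of ✓`smallRange_caccioppoli_twisted`:
`E(u; Q_{M−1}(x₀)) ≤ 5^d·M^d·(2X + 2dτ₀²)`. [folklore] -/
theorem top_scale_twisted (hd : 1 ≤ d) (τ : Fin d → Zd d → (V ≃ₗᵢ[ℝ] V)) (u : Zd d → V) (p : V) (hp : ‖p‖ = 1) (x₀ : Zd d) {N : ℤ} (hN : 1 ≤ N)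
    {ω τ₀ τ₁ : ℝ} (hω0 : 0 ≤ ω) (hτ0 : 0 ≤ τ₀) (hτ1 : 0 ≤ τ₁) (hωτ : ω + τ₀ ≤ 1)
    (hu1 : ∀ y ∈ box x₀ (2 * N + 1), ‖u y‖ = 1) (hω : ∀ y ∈ box x₀ (2 * N + 1), ‖u y - p‖ ≤ ω)
    (hdef : ∀ y ∈ box x₀ (2 * N + 1), ∀ μ (v : V), ‖τ μ y v - v‖ ≤ τ₀ * ‖v‖)
    (hdiv : ∀ y ∈ box x₀ (2 * N), ∀ v : V, ‖∑ μ, ((τ μ y v - v) + ((τ μ (y - unitVec μ)).symm v - v))‖ ≤ τ₁ * ‖v‖)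
    (hopt : ∀ y ∈ box x₀ (2 * N),
      ‖∑ μ, (τ μ y (u (y + unitVec μ)) + (τ μ (y - unitVec μ)).symm (u (y - unitVec μ)))‖ • u y =
        ∑ μ, (τ μ y (u (y + unitVec μ)) + (τ μ (y - unitVec μ)).symm (u (y - unitVec μ)))) :
    ∑ y ∈ box x₀ (N - 1), ∑ μ, ‖u (y + unitVec μ) - u y‖ ^ 2 ≤
      (5 : ℝ) ^ d * (N : ℝ) ^ d * (2 * (448 * d * (ω + τ₀) ^ 2 / (N : ℝ) ^ 2 + 96 * d * ((ω + τ₀) * τ₀) / N + 16 * τ₁ + 704 * d * τ₀ ^ 2) + 2 * d * τ₀ ^ 2) := by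
  set M : ℝ := (N : ℝ) with hM
  set X : ℝ := 448 * d * (ω + τ₀) ^ 2 / M ^ 2 + 96 * d * ((ω + τ₀) * τ₀) / M + 16 * τ₁ + 704 * d * τ₀ ^ 2 with hX
  have hM1 : (1 : ℝ) ≤ M := by rw [hM]; exact_mod_cast hN
  have hX0 : 0 ≤ X := by positivity
  have hcacc := smallRange_caccioppoli_twisted hd τ u p hp x₀ (ρ := N - 1) (s := N) (by linarith) hN hω0 hτ0 hτ1 hωτ
    (fun y hy => hu1 y (by rw [show N - 1 + N + 2 = 2 * N + 1 by ring] at hy; exact hy))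
    (fun y hy => hω y (by rw [show N - 1 + N + 2 = 2 * N + 1 by ring] at hy; exact hy))
    (fun y hy μ v => hdef y (by rw [show N - 1 + N + 2 = 2 * N + 1 by ring] at hy; exact hy) μ v)
    (fun y hy v => hdiv y (by rw [show N - 1 + N + 1 = 2 * N by ring] at hy; exact hy) v)
    (fun y hy => hopt y (by rw [show N - 1 + N + 1 = 2 * N by ring] at hy; exact hy))
  have e1 : (((2 * (N - 1 + N + 1) + 1 : ℤ) : ℝ)) = 4 * M + 1 := by rw [hM]; push_cast; ring
  rw [e1, ← hX] at hcacc
  have h5 : (4 * M + 1) ^ d ≤ (5 : ℝ) ^ d * M ^ d := by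
    rw [← mul_pow]; exact pow_le_pow_left₀ (by positivity) (by linarith) d
  have hflat := flatEnergy_le_twisted τ u (box x₀ (N - 1)) (τ₀ := τ₀)
    (fun y hy μ => hu1 _ (box_mono x₀ (by linarith) (add_unitVec_mem_box hy μ)))
    (fun y hy μ v => hdef y (box_mono x₀ (by linarith) hy) μ v)
  have hcard : ((box x₀ (N - 1)).card : ℝ) ≤ (5 : ℝ) ^ d * M ^ d := by
    rw [card_box x₀ (by linarith)]
    have e3 : ((2 * (N - 1) + 1 : ℤ) : ℝ) = 2 * M - 1 := by rw [hM]; push_cast; ring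
    rw [e3]
    calc (2 * M - 1) ^ d ≤ (4 * M + 1) ^ d := pow_le_pow_left₀ (by linarith) (by linarith) d
      _ ≤ (5 : ℝ) ^ d * M ^ d := h5
  have t1 : ∑ y ∈ box x₀ (N - 1), ∑ μ, ‖τ μ y (u (y + unitVec μ)) - u y‖ ^ 2 ≤ (5 : ℝ) ^ d * M ^ d * X :=
    hcacc.trans (mul_le_mul_of_nonneg_right h5 hX0)
  have t2 : 2 * (d : ℝ) * τ₀ ^ 2 * ((box x₀ (N - 1)).card : ℝ) ≤ 2 * d * τ₀ ^ 2 * ((5 : ℝ) ^ d * M ^ d) :=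
    mul_le_mul_of_nonneg_left hcard (by positivity)
  refine hflat.trans ?_
  nlinarith [t1, t2]

/-! ## §4 ★★ The flat energy at the centre after `K` twisted decay steps -/

set_option maxHeartbeats 400000 in
/-- ★★ **THE FLAT ENERGY AT THE CENTRE AFTER `K` TWISTED DECAY STEPS.**  `A := 2^d(1+56d)^d(8(d+1))^{d+1}`, `m ≥ 8A·2^d + 4`, `ω ≤ m^{−(d−1)}∕(4(8A+4))`, `ω + τ₀ ≤ 1`;
`u` unit with `‖u − p‖ ≤ ω` and transports of defect `≤ τ₀` on `Q_{2m^K+1}(x₀)`, divergence defect `≤ τ₁` and twisted one-site optimality on `Q_{2m^K}(x₀)`.  Then (`M := m^K`)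
`Σ_μ ‖u(x₀+e_μ) − u(x₀)‖² ≤ 1792d·5^d·ω²·M⁻¹ + (5^d(3394d+32) + (4A+2)·8d·2^d·m^d)·(τ₀+τ₁)·M` (`geometric_iter_add` over `decay_step_twisted`, sources by `source_term_le` +
`sum_pow_le_pow`, top by `top_scale_twisted` + `top_scale_arith`). [folklore] [cite: Giaquinta1984, Ch. III Lemma 2.1 p.86, Ch. VI §1 Thm 1.1 pp.128-131] -/
theorem smallRange_energy_at_centre_le_twisted [FiniteDimensional ℝ V] (hd : 1 ≤ d) (τ : Fin d → Zd d → (V ≃ₗᵢ[ℝ] V)) (u : Zd d → V) (p : V) (hp : ‖p‖ = 1)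
    (x₀ : Zd d) {m : ℕ} (hm : 8 * ((2 : ℝ) ^ d * (1 + 56 * d) ^ d * (8 * ((d : ℝ) + 1)) ^ (d + 1)) * 2 ^ d + 4 ≤ m) (K : ℕ) {ω τ₀ τ₁ : ℝ}
    (hω0 : 0 ≤ ω) (hτ0 : 0 ≤ τ₀) (hτ1 : 0 ≤ τ₁) (hωτ : ω + τ₀ ≤ 1)
    (hωsmall : ω ≤ ((m : ℝ) ^ (d - 1))⁻¹ / (4 * (8 * ((2 : ℝ) ^ d * (1 + 56 * d) ^ d * (8 * ((d : ℝ) + 1)) ^ (d + 1)) + 4)))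
    (hu1 : ∀ y ∈ box x₀ (2 * (m : ℤ) ^ K + 1), ‖u y‖ = 1) (hω : ∀ y ∈ box x₀ (2 * (m : ℤ) ^ K + 1), ‖u y - p‖ ≤ ω)
    (hdef : ∀ y ∈ box x₀ (2 * (m : ℤ) ^ K + 1), ∀ μ (v : V), ‖τ μ y v - v‖ ≤ τ₀ * ‖v‖)
    (hdiv : ∀ y ∈ box x₀ (2 * (m : ℤ) ^ K), ∀ v : V, ‖∑ μ, ((τ μ y v - v) + ((τ μ (y - unitVec μ)).symm v - v))‖ ≤ τ₁ * ‖v‖)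
    (hopt : ∀ y ∈ box x₀ (2 * (m : ℤ) ^ K),
      ‖∑ μ, (τ μ y (u (y + unitVec μ)) + (τ μ (y - unitVec μ)).symm (u (y - unitVec μ)))‖ • u y =
        ∑ μ, (τ μ y (u (y + unitVec μ)) + (τ μ (y - unitVec μ)).symm (u (y - unitVec μ)))) :
    ∑ μ, ‖u (x₀ + unitVec μ) - u x₀‖ ^ 2 ≤
      1792 * d * (5 : ℝ) ^ d * ω ^ 2 * ((m : ℝ) ^ K)⁻¹ +
        ((5 : ℝ) ^ d * (3394 * d + 32) + (4 * ((2 : ℝ) ^ d * (1 + 56 * d) ^ d * (8 * ((d : ℝ) + 1)) ^ (d + 1)) + 2) * (8 * d) * 2 ^ d * (m : ℝ) ^ d) *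
          (τ₀ + τ₁) * (m : ℝ) ^ K := by
  classical
  set A : ℝ := (2 : ℝ) ^ d * (1 + 56 * d) ^ d * (8 * ((d : ℝ) + 1)) ^ (d + 1) with hA
  have hA0 : 0 ≤ A := by positivity
  have h2d : (1 : ℝ) ≤ (2 : ℝ) ^ d := one_le_pow₀ (by norm_num)
  have hm4R : (4 : ℝ) ≤ m := by nlinarith
  have hm0 : (0 : ℝ) < m := by linarith
  have hm1 : (1 : ℝ) ≤ m := by linarith
  have hm2R : (2 : ℝ) ≤ m := by linarith
  have hdR : (1 : ℝ) ≤ d := by exact_mod_cast hd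
  have hm1N : 1 ≤ m := by exact_mod_cast hm1
  -- flat energies at the radii `m^k − 1`, the factor, the source
  set E : ℕ → ℝ := fun k => ∑ y ∈ box x₀ ((m : ℤ) ^ k - 1), ∑ μ, ‖u (y + unitVec μ) - u y‖ ^ 2 with hE
  set θ : ℝ := ((m : ℝ) ^ (d - 1))⁻¹ with hθ
  have hθ0 : 0 < θ := by positivity
  set P : ℝ := (4 * A + 2) * (8 * d * ω * τ₀) with hP
  have hP0 : 0 ≤ P := by positivity
  set S : ℕ → ℝ := fun k => P * (2 * (m : ℝ) ^ (k + 1) - 3) ^ d with hS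
  -- the steps
  have hstep : ∀ k, k < K → E k ≤ θ * E (k + 1) + S k := by
    intro k hk
    have hKk : (m : ℤ) ^ (k + 1) ≤ (m : ℤ) ^ K := pow_le_pow_right₀ (by exact_mod_cast hm1N) (by omega)
    have hmK0 : (0 : ℤ) ≤ (m : ℤ) ^ K := by positivity
    have hsub2 : box x₀ ((m : ℤ) ^ (k + 1)) ⊆ box x₀ (2 * (m : ℤ) ^ K + 1) := box_mono x₀ (by linarith)
    have hsub1' : box x₀ ((m : ℤ) ^ (k + 1) - 1) ⊆ box x₀ (2 * (m : ℤ) ^ K + 1) := box_mono x₀ (by linarith)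
    have hsub1 : box x₀ ((m : ℤ) ^ (k + 1) - 1) ⊆ box x₀ (2 * (m : ℤ) ^ K) := box_mono x₀ (by linarith)
    have h := decay_step_twisted hd τ u p x₀ (m := m) hm k hω0 hτ0 hωsmall (fun y hy => hu1 y (hsub2 hy)) (fun y hy => hω y (hsub2 hy))
      (fun y hy μ v => hdef y (hsub1' hy) μ v) (fun y hy => hopt y (hsub1 hy))
    rw [← hA, ← hP] at h
    exact h
  have hiter := geometric_iter_add E S hθ0.le K hstep
  -- the sources
  have hsrc : ∑ k ∈ Finset.range K, θ ^ k * S k ≤ P * (2 : ℝ) ^ d * (m : ℝ) ^ d * (m : ℝ) ^ K := by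
    calc ∑ k ∈ Finset.range K, θ ^ k * S k ≤ ∑ k ∈ Finset.range K, P * (2 : ℝ) ^ d * (m : ℝ) ^ d * (m : ℝ) ^ k :=
          Finset.sum_le_sum fun k _ => by rw [hS, hθ]; exact source_term_le hd hm4R hP0 k
      _ = P * (2 : ℝ) ^ d * (m : ℝ) ^ d * ∑ k ∈ Finset.range K, (m : ℝ) ^ k := by rw [Finset.mul_sum]
      _ ≤ P * (2 : ℝ) ^ d * (m : ℝ) ^ d * (m : ℝ) ^ K := mul_le_mul_of_nonneg_left (sum_pow_le_pow hm2R K) (by positivity)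
  -- the top scale
  set M : ℝ := (m : ℝ) ^ K with hM
  have hM1 : (1 : ℝ) ≤ M := one_le_pow₀ hm1
  have hM0 : (0 : ℝ) < M := by positivity
  have hmK1 : (1 : ℤ) ≤ (m : ℤ) ^ K := one_le_pow₀ (by exact_mod_cast hm1N)
  have htop0 := top_scale_twisted hd τ u p hp x₀ (N := (m : ℤ) ^ K) hmK1 hω0 hτ0 hτ1 hωτ hu1 hω hdef hdiv hopt
  have eM : ((((m : ℤ) ^ K : ℤ) : ℝ)) = M := by rw [hM]; push_cast; ring
  rw [eM] at htop0
  set X : ℝ := 448 * d * (ω + τ₀) ^ 2 / M ^ 2 + 96 * d * ((ω + τ₀) * τ₀) / M + 16 * τ₁ + 704 * d * τ₀ ^ 2 with hX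
  have htop : E K ≤ (5 : ℝ) ^ d * M ^ d * (2 * X + 2 * d * τ₀ ^ 2) := htop0
  have hθK : θ ^ K * ((5 : ℝ) ^ d * M ^ d * (2 * X + 2 * d * τ₀ ^ 2)) = (5 : ℝ) ^ d * (M * (2 * X + 2 * d * τ₀ ^ 2)) := by
    have h1 : θ ^ K * M ^ d = M := by rw [hθ, hM]; exact theta_pow_mul_pow hd hm0 K
    calc θ ^ K * ((5 : ℝ) ^ d * M ^ d * (2 * X + 2 * d * τ₀ ^ 2)) = (5 : ℝ) ^ d * ((θ ^ K * M ^ d) * (2 * X + 2 * d * τ₀ ^ 2)) := by ring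
      _ = (5 : ℝ) ^ d * (M * (2 * X + 2 * d * τ₀ ^ 2)) := by rw [h1]
  have harith : M * (2 * X + 2 * d * τ₀ ^ 2) ≤ 1792 * d * ω ^ 2 / M + (3394 * d + 32) * (τ₀ + τ₁) * M := by
    rw [hX]; exact top_scale_arith hdR hM1 hω0 hτ0 hτ1 hωτ
  -- the one-point box and the assembly
  have hbox0 : ∑ μ, ‖u (x₀ + unitVec μ) - u x₀‖ ^ 2 ≤ E 0 := by
    rw [hE]; dsimp only
    rw [pow_zero, sub_self]
    exact Finset.single_le_sum (f := fun y => ∑ μ, ‖u (y + unitVec μ) - u y‖ ^ 2) (fun _ _ => Finset.sum_nonneg fun _ _ => sq_nonneg _)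
      (self_mem_box x₀ le_rfl)
  have h5d : (0 : ℝ) ≤ (5 : ℝ) ^ d := by positivity
  have hPM : P * (2 : ℝ) ^ d * (m : ℝ) ^ d * M ≤ (4 * A + 2) * (8 * d) * 2 ^ d * (m : ℝ) ^ d * (τ₀ + τ₁) * M := by
    have hω1 : ω ≤ 1 := by linarith
    have hωτ' : ω * τ₀ ≤ τ₀ + τ₁ := by
      calc ω * τ₀ ≤ 1 * τ₀ := mul_le_mul_of_nonneg_right hω1 hτ0
        _ ≤ τ₀ + τ₁ := by linarith
    have h0 : (0 : ℝ) ≤ (4 * A + 2) * (8 * d) * 2 ^ d * (m : ℝ) ^ d * M := by positivity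
    have e1 : P * (2 : ℝ) ^ d * (m : ℝ) ^ d * M = ((4 * A + 2) * (8 * d) * 2 ^ d * (m : ℝ) ^ d * M) * (ω * τ₀) := by rw [hP]; ring
    have e2 : (4 * A + 2) * (8 * d) * 2 ^ d * (m : ℝ) ^ d * (τ₀ + τ₁) * M = ((4 * A + 2) * (8 * d) * 2 ^ d * (m : ℝ) ^ d * M) * (τ₀ + τ₁) := by ring
    rw [e1, e2]; exact mul_le_mul_of_nonneg_left hωτ' h0
  calc ∑ μ, ‖u (x₀ + unitVec μ) - u x₀‖ ^ 2 ≤ E 0 := hbox0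
    _ ≤ θ ^ K * E K + ∑ k ∈ Finset.range K, θ ^ k * S k := hiter
    _ ≤ θ ^ K * ((5 : ℝ) ^ d * M ^ d * (2 * X + 2 * d * τ₀ ^ 2)) + P * (2 : ℝ) ^ d * (m : ℝ) ^ d * M :=
        add_le_add (mul_le_mul_of_nonneg_left htop (pow_nonneg hθ0.le K)) hsrc
    _ = (5 : ℝ) ^ d * (M * (2 * X + 2 * d * τ₀ ^ 2)) + P * (2 : ℝ) ^ d * (m : ℝ) ^ d * M := by rw [hθK]
    _ ≤ (5 : ℝ) ^ d * (1792 * d * ω ^ 2 / M + (3394 * d + 32) * (τ₀ + τ₁) * M) + (4 * A + 2) * (8 * d) * 2 ^ d * (m : ℝ) ^ d * (τ₀ + τ₁) * M :=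
        add_le_add (mul_le_mul_of_nonneg_left harith h5d) hPM
    _ = _ := by rw [div_eq_mul_inv]; ring

/-! ## §5 ★★★ The twisted Hölder radius law at a general radius -/

set_option maxHeartbeats 400000 in
/-- ★★★ **THE HÖLDER RADIUS LAW FOR SMALL-RANGE ONE-SITE-OPTIMAL SPHERE MAPS WITH ISOMETRIC BOND TRANSPORTS (exponent `½`, squared form, twisted).**
`V` finite-dimensional, `d ≥ 1`.  There are `ω₀ = ω₀(d) > 0`, `C = C(d) > 0` such that for every integer radius `R ≥ 1`, all transports `τ` with sup defect
`‖τ μ y v − v‖ ≤ τ₀‖v‖` on `Q_{2R+1}(x₀)` and divergence defect `‖Σ_μ((τ μ y − 1)v + ((τ μ (y−e_μ))⁻¹ − 1)v)‖ ≤ τ₁‖v‖` on `Q_{2R}(x₀)`, every `u : ℤ^d → V` with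
`‖u‖ = 1`, `‖u − p‖ ≤ ω` on `Q_{2R+1}(x₀)` (`‖p‖ = 1`, `0 ≤ ω ≤ ω₀`, `ω + τ₀ ≤ 1`, `0 ≤ τ₀, τ₁`), twisted one-site optimal on `Q_{2R}(x₀)`, and every axis `μ`:
`‖τ μ x₀ (u(x₀+e_μ)) − u(x₀)‖² ≤ C·(ω²∕R + (τ₀ + τ₁)·R)` — the bond law `‖D_τu(x₀)‖ ≤ √C·(ω·R^{−1∕2} + √(τ₀+τ₁)·R^{1∕2})`.
[folklore] [cite: Giaquinta1984, Ch. VI §1 Thm 1.1 pp.128-131, §3 Thm 3.2 p.137, Ch. III Lemma 2.1 p.86; Balaban1985BackgroundPropagators, §3 (3.8)-(3.25) pp.392-394] -/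
theorem smallRange_holder_law_twisted [FiniteDimensional ℝ V] (hd : 1 ≤ d) : ∃ ω₀ C : ℝ, 0 < ω₀ ∧ 0 < C ∧
    ∀ (τ : Fin d → Zd d → (V ≃ₗᵢ[ℝ] V)) (u : Zd d → V) (p : V) (x₀ : Zd d) (R : ℕ) (ω τ₀ τ₁ : ℝ), 1 ≤ R → ‖p‖ = 1 →
      0 ≤ ω → 0 ≤ τ₀ → 0 ≤ τ₁ → ω ≤ ω₀ → ω + τ₀ ≤ 1 →
      (∀ y ∈ box x₀ (2 * (R : ℤ) + 1), ‖u y‖ = 1) → (∀ y ∈ box x₀ (2 * (R : ℤ) + 1), ‖u y - p‖ ≤ ω) →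
      (∀ y ∈ box x₀ (2 * (R : ℤ) + 1), ∀ μ (v : V), ‖τ μ y v - v‖ ≤ τ₀ * ‖v‖) →
      (∀ y ∈ box x₀ (2 * (R : ℤ)), ∀ v : V, ‖∑ μ, ((τ μ y v - v) + ((τ μ (y - unitVec μ)).symm v - v))‖ ≤ τ₁ * ‖v‖) →
      (∀ y ∈ box x₀ (2 * (R : ℤ)),
        ‖∑ μ, (τ μ y (u (y + unitVec μ)) + (τ μ (y - unitVec μ)).symm (u (y - unitVec μ)))‖ • u y =
          ∑ μ, (τ μ y (u (y + unitVec μ)) + (τ μ (y - unitVec μ)).symm (u (y - unitVec μ)))) →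
      ∀ μ : Fin d, ‖τ μ x₀ (u (x₀ + unitVec μ)) - u x₀‖ ^ 2 ≤ C * (ω ^ 2 / R + (τ₀ + τ₁) * R) := by
  classical
  set A : ℝ := (2 : ℝ) ^ d * (1 + 56 * d) ^ d * (8 * ((d : ℝ) + 1)) ^ (d + 1) with hA
  have hA0 : 0 ≤ A := by positivity
  set m : ℕ := ⌈8 * A * 2 ^ d + 4⌉₊ with hm
  have hmge : 8 * A * 2 ^ d + 4 ≤ (m : ℝ) := Nat.le_ceil _
  have h2d : (1 : ℝ) ≤ (2 : ℝ) ^ d := one_le_pow₀ (by norm_num)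
  have hm4R : (4 : ℝ) ≤ m := by nlinarith
  have hm4 : 4 ≤ m := by exact_mod_cast hm4R
  have hm0 : (0 : ℝ) < m := by linarith
  have hm2 : 2 ≤ m := by omega
  set ω₀ : ℝ := min 1 (((m : ℝ) ^ (d - 1))⁻¹ / (4 * (8 * A + 4))) with hω₀
  set C1 : ℝ := 1792 * d * (5 : ℝ) ^ d with hC1
  set C2 : ℝ := (5 : ℝ) ^ d * (3394 * d + 32) + (4 * A + 2) * (8 * d) * 2 ^ d * (m : ℝ) ^ d with hC2
  have hC10 : 0 ≤ C1 := by positivity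
  have hC20 : 0 ≤ C2 := by positivity
  refine ⟨ω₀, 2 * C1 * m + 2 * C2 + 2, by positivity, by positivity, ?_⟩
  intro τ u p x₀ R ω τ₀ τ₁ hR hp hω0 hτ0 hτ1 hωle hωτ hu1 hω hdef hdiv hopt μ
  have hωsmall : ω ≤ ((m : ℝ) ^ (d - 1))⁻¹ / (4 * (8 * A + 4)) := hωle.trans (min_le_right _ _)
  -- `m^K ≤ R < m^{K+1}`
  set K : ℕ := Nat.log m R with hK
  have hR0 : R ≠ 0 := by omega
  have hlow : m ^ K ≤ R := Nat.pow_log_le_self m hR0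
  have hup : R < m ^ (K + 1) := Nat.lt_pow_succ_log_self (by omega) R
  have hlowZ : (m : ℤ) ^ K ≤ (R : ℤ) := by exact_mod_cast hlow
  have hlowR : (m : ℝ) ^ K ≤ (R : ℝ) := by exact_mod_cast hlow
  have hsub1 : box x₀ (2 * (m : ℤ) ^ K + 1) ⊆ box x₀ (2 * (R : ℤ) + 1) := box_mono x₀ (by linarith)
  have hsub0 : box x₀ (2 * (m : ℤ) ^ K) ⊆ box x₀ (2 * (R : ℤ)) := box_mono x₀ (by linarith)
  have hmain := smallRange_energy_at_centre_le_twisted hd τ u p hp x₀ (m := m) (by rw [← hA]; exact hmge) K hω0 hτ0 hτ1 hωτ (by rw [← hA]; exact hωsmall)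
    (fun y hy => hu1 y (hsub1 hy)) (fun y hy => hω y (hsub1 hy)) (fun y hy μ v => hdef y (hsub1 hy) μ v) (fun y hy v => hdiv y (hsub0 hy) v)
    (fun y hy => hopt y (hsub0 hy))
  -- `(m^K)⁻¹ ≤ m∕R`, `m^K ≤ R`
  have hRpos : (0 : ℝ) < R := by exact_mod_cast (show 0 < R by omega)
  have hmK0 : (0 : ℝ) < (m : ℝ) ^ K := by positivity
  have hinv : ((m : ℝ) ^ K)⁻¹ ≤ (m : ℝ) / R := by
    rw [inv_eq_one_div, div_le_div_iff₀ hmK0 hRpos, one_mul]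
    have : (R : ℝ) < (m : ℝ) ^ (K + 1) := by exact_mod_cast hup
    rw [pow_succ] at this
    linarith
  -- the flat centre bond, then the twisted one
  have hflatμ : ‖u (x₀ + unitVec μ) - u x₀‖ ^ 2 ≤ C1 * m * (ω ^ 2 / R) + C2 * ((τ₀ + τ₁) * R) := by
    have t0 : ‖u (x₀ + unitVec μ) - u x₀‖ ^ 2 ≤ ∑ ν, ‖u (x₀ + unitVec ν) - u x₀‖ ^ 2 :=
      Finset.single_le_sum (f := fun ν => ‖u (x₀ + unitVec ν) - u x₀‖ ^ 2) (fun _ _ => sq_nonneg _) (Finset.mem_univ μ)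
    have t1 : 1792 * d * (5 : ℝ) ^ d * ω ^ 2 * ((m : ℝ) ^ K)⁻¹ ≤ C1 * m * (ω ^ 2 / R) := by
      calc 1792 * d * (5 : ℝ) ^ d * ω ^ 2 * ((m : ℝ) ^ K)⁻¹ ≤ 1792 * d * (5 : ℝ) ^ d * ω ^ 2 * ((m : ℝ) / R) :=
            mul_le_mul_of_nonneg_left hinv (by positivity)
        _ = C1 * m * (ω ^ 2 / R) := by rw [hC1]; ring
    have t2 : C2 * (τ₀ + τ₁) * (m : ℝ) ^ K ≤ C2 * ((τ₀ + τ₁) * R) := by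
      rw [mul_assoc]; exact mul_le_mul_of_nonneg_left (mul_le_mul_of_nonneg_left hlowR (by positivity)) hC20
    have hm' := hmain
    rw [← hC2] at hm'
    linarith
  have hx0 : x₀ ∈ box x₀ (2 * (R : ℤ) + 1) := self_mem_box x₀ (by positivity)
  have hb1 : ‖u (x₀ + unitVec μ)‖ = 1 := hu1 _ (box_mono x₀ (by linarith) (add_unitVec_mem_box (self_mem_box x₀ (by positivity : (0:ℤ) ≤ 2 * (R : ℤ))) μ))
  have htw : ‖τ μ x₀ (u (x₀ + unitVec μ)) - u x₀‖ ≤ ‖u (x₀ + unitVec μ) - u x₀‖ + τ₀ := by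
    have e : τ μ x₀ (u (x₀ + unitVec μ)) - u x₀ = (τ μ x₀ (u (x₀ + unitVec μ)) - u (x₀ + unitVec μ)) + (u (x₀ + unitVec μ) - u x₀) := by abel
    rw [e]
    calc ‖(τ μ x₀ (u (x₀ + unitVec μ)) - u (x₀ + unitVec μ)) + (u (x₀ + unitVec μ) - u x₀)‖
        ≤ ‖τ μ x₀ (u (x₀ + unitVec μ)) - u (x₀ + unitVec μ)‖ + ‖u (x₀ + unitVec μ) - u x₀‖ := norm_add_le _ _
      _ ≤ τ₀ * ‖u (x₀ + unitVec μ)‖ + ‖u (x₀ + unitVec μ) - u x₀‖ := add_le_add (hdef x₀ hx0 μ _) le_rfl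
      _ = ‖u (x₀ + unitVec μ) - u x₀‖ + τ₀ := by rw [hb1, mul_one, add_comm]
  have hsq : ‖τ μ x₀ (u (x₀ + unitVec μ)) - u x₀‖ ^ 2 ≤ 2 * ‖u (x₀ + unitVec μ) - u x₀‖ ^ 2 + 2 * τ₀ ^ 2 := by
    have h0 : 0 ≤ ‖τ μ x₀ (u (x₀ + unitVec μ)) - u x₀‖ := norm_nonneg _
    have h1 := pow_le_pow_left₀ h0 htw 2
    nlinarith [h1, sq_nonneg (‖u (x₀ + unitVec μ) - u x₀‖ - τ₀)]
  have hτ01 : τ₀ ≤ 1 := by linarith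
  have hR1 : (1 : ℝ) ≤ R := by exact_mod_cast hR
  have hτsq : τ₀ ^ 2 ≤ (τ₀ + τ₁) * R := by
    calc τ₀ ^ 2 = τ₀ * τ₀ := sq τ₀
      _ ≤ 1 * τ₀ := mul_le_mul_of_nonneg_right hτ01 hτ0
      _ = τ₀ * 1 := by ring
      _ ≤ (τ₀ + τ₁) * R := mul_le_mul (by linarith) hR1 zero_le_one (by positivity)
  have hω2R : 0 ≤ ω ^ 2 / R := by positivity
  have hτR : 0 ≤ (τ₀ + τ₁) * R := by positivity
  have hkey : 0 ≤ 2 * (C1 * m) * ((τ₀ + τ₁) * R) + 2 * C2 * (ω ^ 2 / R) + 2 * (ω ^ 2 / R) := by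
    have := mul_nonneg hC10 hm0.le
    positivity
  calc ‖τ μ x₀ (u (x₀ + unitVec μ)) - u x₀‖ ^ 2 ≤ 2 * ‖u (x₀ + unitVec μ) - u x₀‖ ^ 2 + 2 * τ₀ ^ 2 := hsq
    _ ≤ 2 * (C1 * m * (ω ^ 2 / R) + C2 * ((τ₀ + τ₁) * R)) + 2 * ((τ₀ + τ₁) * R) := by linarith [hflatμ, hτsq]
    _ = (2 * C1 * m + 2 * C2 + 2) * (ω ^ 2 / R + (τ₀ + τ₁) * R) - (2 * (C1 * m) * ((τ₀ + τ₁) * R) + 2 * C2 * (ω ^ 2 / R) + 2 * (ω ^ 2 / R)) := by ring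
    _ ≤ (2 * C1 * m + 2 * C2 + 2) * (ω ^ 2 / R + (τ₀ + τ₁) * R) := by linarith [hkey]


/-- ★★★ **THE SAME LAW WITHOUT A DIVERGENCE LETTER** (the consumer's form: [T2] ✓`exists_flatShadow` (c) supplies only the sup defect `τ₀`; the divergence defect is then
`≤ 2dτ₀` by the triangle inequality): `‖τ μ x₀ (u(x₀+e_μ)) − u(x₀)‖² ≤ C·(ω²∕R + τ₀·R)`. [folklore] [cite: Giaquinta1984, Ch. VI §1 Thm 1.1 pp.128-131] -/
theorem smallRange_holder_law_twisted' [FiniteDimensional ℝ V] (hd : 1 ≤ d) : ∃ ω₀ C : ℝ, 0 < ω₀ ∧ 0 < C ∧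
    ∀ (τ : Fin d → Zd d → (V ≃ₗᵢ[ℝ] V)) (u : Zd d → V) (p : V) (x₀ : Zd d) (R : ℕ) (ω τ₀ : ℝ), 1 ≤ R → ‖p‖ = 1 →
      0 ≤ ω → 0 ≤ τ₀ → ω ≤ ω₀ → ω + τ₀ ≤ 1 →
      (∀ y ∈ box x₀ (2 * (R : ℤ) + 1), ‖u y‖ = 1) → (∀ y ∈ box x₀ (2 * (R : ℤ) + 1), ‖u y - p‖ ≤ ω) →
      (∀ y ∈ box x₀ (2 * (R : ℤ) + 1), ∀ μ (v : V), ‖τ μ y v - v‖ ≤ τ₀ * ‖v‖) →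
      (∀ y ∈ box x₀ (2 * (R : ℤ)),
        ‖∑ μ, (τ μ y (u (y + unitVec μ)) + (τ μ (y - unitVec μ)).symm (u (y - unitVec μ)))‖ • u y =
          ∑ μ, (τ μ y (u (y + unitVec μ)) + (τ μ (y - unitVec μ)).symm (u (y - unitVec μ)))) →
      ∀ μ : Fin d, ‖τ μ x₀ (u (x₀ + unitVec μ)) - u x₀‖ ^ 2 ≤ C * (ω ^ 2 / R + τ₀ * R) := by
  obtain ⟨ω₀, C, hω₀, hC, H⟩ := smallRange_holder_law_twisted (V := V) hd
  refine ⟨ω₀, C * (1 + 2 * d), hω₀, by positivity, ?_⟩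
  intro τ u p x₀ R ω τ₀ hR hp hω0 hτ0 hωle hωτ hu1 hω hdef hopt μ
  have hdiv : ∀ y ∈ box x₀ (2 * (R : ℤ)), ∀ v : V, ‖∑ ν, ((τ ν y v - v) + ((τ ν (y - unitVec ν)).symm v - v))‖ ≤ (2 * d * τ₀) * ‖v‖ := by
    intro y hy v
    have hy1 : y ∈ box x₀ (2 * (R : ℤ) + 1) := box_mono x₀ (by linarith) hy
    have hy2 : ∀ ν, y - unitVec ν ∈ box x₀ (2 * (R : ℤ) + 1) := fun ν => sub_unitVec_mem_box hy ν
    calc ‖∑ ν, ((τ ν y v - v) + ((τ ν (y - unitVec ν)).symm v - v))‖ ≤ ∑ ν, ‖(τ ν y v - v) + ((τ ν (y - unitVec ν)).symm v - v)‖ := norm_sum_le _ _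
      _ ≤ ∑ _ν : Fin d, (τ₀ * ‖v‖ + τ₀ * ‖v‖) := Finset.sum_le_sum fun ν _ =>
          (norm_add_le _ _).trans (add_le_add (hdef y hy1 ν v) (norm_symm_sub_le _ (fun w => hdef _ (hy2 ν) ν w) v))
      _ = (2 * d * τ₀) * ‖v‖ := by rw [Finset.sum_const, Finset.card_univ, Fintype.card_fin, nsmul_eq_mul]; ring
  have h := H τ u p x₀ R ω τ₀ (2 * d * τ₀) hR hp hω0 hτ0 (by positivity) hωle hωτ hu1 hω hdef hdiv hopt μ
  have hRpos : (0 : ℝ) < R := by exact_mod_cast (show 0 < R by omega)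
  have hd0 : (0 : ℝ) ≤ d := Nat.cast_nonneg d
  have hω2R : 0 ≤ ω ^ 2 / R := by positivity
  calc ‖τ μ x₀ (u (x₀ + unitVec μ)) - u x₀‖ ^ 2 ≤ C * (ω ^ 2 / R + (τ₀ + 2 * d * τ₀) * R) := h
    _ = C * (1 + 2 * d) * (ω ^ 2 / R + τ₀ * R) - C * (2 * d) * (ω ^ 2 / R) := by ring
    _ ≤ C * (1 + 2 * d) * (ω ^ 2 / R + τ₀ * R) := by
        have : 0 ≤ C * (2 * d) * (ω ^ 2 / R) := by positivity
        linarith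

end Summit.QuantumFields.YangMills.Theorems.PoincareLipschitzSphereMapSmallRangeHolderTwisted

end
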